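import Literature.NumberTheory.Automorphic.TateLocalFactors
import Mathlib.MeasureTheory.Function.LocallyIntegrable
import Mathlib.MeasureTheory.Integral.Bochner.ContinuousLinearMap
import Mathlib.MeasureTheory.Measure.OpenPos
import Mathlib.Topology.Separation.Profinite
import Mathlib.LinearAlgebra.Matrix.NonsingularInverse
import HarnessLib

/-!
# The `L²` pairing on Schwartz–Bruhat functions: positive definiteness, sesquilinearity, and the dual family of a basis
# of a finite-dimensional subspace

Topic `RepresentationTheory/HeisenbergGroup`; namespace `Literature.RepresentationTheory.HeisenbergGroup`.  KERNEL ONLY: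
theorems; no definition, no named fact, no record, no `sorry`.  Generic analysis over the tree's Schwartz–Bruhat space
`SchwartzBruhat X` (`Literature/NumberTheory/Automorphic/TateLocalFactors.lean`: locally constant, compactly supported
complex functions) on a topological space `X` with a measure `μ` that is finite on compact sets and charges non-empty
open sets (intended: `X = F_vᴺ` with a Haar measure).  Companion of `SchwartzKernelTrace.lean` (the trace of a
finite-rank kernel operator), which consumes §3.

DEF-FREE CURRENCY.  The `L²(μ)` pairing of two Schwartz–Bruhat functions is written out as `∫ x, conj (f x) * g x ∂μ`
(conjugate-linear in the FIRST slot).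

* §1 bookkeeping: Schwartz–Bruhat functions are continuous with compact support, `conj f · g` and `k · f` are integrable
  for continuous `g`, `k`, indicators of compact open sets are Schwartz–Bruhat, compact open neighbourhoods form a basis
  of a locally compact Hausdorff totally disconnected space, and the pairing is POSITIVE DEFINITE
  (`schwartzBruhat_eq_zero_of_integral_conj_mul_self_eq_zero`).
* §3 the pairing is sesquilinear on finite linear combinations; **the Gram matrix of a basis `b` of a finite-dimensional
  `V ≤ 𝒮(X)` is invertible** (`gram_mulVec_injective`) and **`b` has a `⟪·,·⟫`-DUAL FAMILY** `d i ∈ V`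
  (`exists_dual_family`: `∫ conj (d i) · (b j) = δ_ij`, the `b`-coordinates of `w ∈ V` are `∫ conj (d i) · w`, and
  `⟪v, f⟫ = Σ_i ⟪d i, f⟫ ⟪v, b i⟫` for `v ∈ V` — i.e. `f ↦ Σ_i ⟪d i, f⟫ b i` is the orthogonal projection onto `V`).

Use (cell `hodgecm-mathlib`, c3 wall `NonPeriodic₁₁`, character route of B-p04/B-p21): finite-dimensional spaces of
`K`-fixed vectors in the rank-one oscillator representation on `𝒮(F_v)`.  Folklore linear algebra (Gram–Schmidt /
Riesz in finite dimension); nothing of the cited sources is asserted.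

## References
* [BernsteinZelevinsky1976] I. N. Bernstein, A. V. Zelevinsky, *Representations of the group GL(n,F) where F is a
  non-archimedean local field*, Russian Math. Surveys 31:3 (1976), §1.1–§1.3 (`l`-spaces, `S(X)`, distributions).
* [ReedSimonI1980] M. Reed, B. Simon, *Methods of Modern Mathematical Physics I: Functional Analysis* (rev. ed. 1980),
  §II.1 Example 2 (the `L²` inner product), Thm. II.3 (projection theorem), Thm. II.4 (Riesz lemma).
* [HornJohnson2013] R. A. Horn, C. R. Johnson, *Matrix Analysis*, 2nd ed. (2013), Thm. 7.2.10 (Gram matrices).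
* [Bruhat1961] F. Bruhat, *Distributions sur un groupe localement compact et applications à l'étude des représentations
  des groupes p-adiques*, Bull. SMF 89 (1961), §9 (Schwartz–Bruhat functions on totally disconnected spaces).
* [WeilBNT1967] A. Weil, *Basic Number Theory* (1967), Chap. VII §2 (standard functions, integration against them).
-/

set_option autoImplicit false

noncomputable section

open MeasureTheory Filter Set
open scoped ComplexConjugate Topology BigOperators
open Literature.NumberTheory.Automorphic

namespace Literature.RepresentationTheory.HeisenbergGroup

/-! ## §1 Bookkeeping on Schwartz–Bruhat functions and the `L²` pairing -/

section Bookkeeping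

variable {X : Type*} [TopologicalSpace X]

/-- a Schwartz–Bruhat function is continuous (it is locally constant). [cite: BernsteinZelevinsky1976, §1.2] [cite: Bruhat1961, §9] -/
theorem continuous_schwartzBruhat (f : SchwartzBruhat X) : Continuous (f : X → ℂ) :=
  f.2.1.continuous

/-- a Schwartz–Bruhat function has compact support. [cite: BernsteinZelevinsky1976, §1.2] [cite: Bruhat1961, §9] -/
theorem hasCompactSupport_schwartzBruhat (f : SchwartzBruhat X) : HasCompactSupport (f : X → ℂ) :=
  f.2.2

/-- the indicator function of a clopen set (times a constant) is locally constant. [folklore] -/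
private theorem isLocallyConstant_indicator_const_of_isClopen {C : Set X} (hC : IsClopen C) (c : ℂ) :
    IsLocallyConstant (C.indicator fun _ => c) := by
  rw [IsLocallyConstant.iff_exists_open]
  intro x
  by_cases hx : x ∈ C
  · exact ⟨C, hC.2, hx, fun y hy => by rw [indicator_of_mem hy, indicator_of_mem hx]⟩
  · exact ⟨Cᶜ, hC.1.isOpen_compl, hx, fun y hy => by
      rw [indicator_of_notMem (notMem_of_mem_compl hy), indicator_of_notMem hx]⟩

/-- the indicator function of a COMPACT OPEN set is a Schwartz–Bruhat function (Hausdorff `X`): the characteristic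
functions of compact open sets span `S(X)`. [cite: BernsteinZelevinsky1976, §1.2] [cite: WeilBNT1967, Chap. VII §2, Def. 1] -/
theorem indicator_mem_schwartzBruhat_of_isCompact_isOpen [T2Space X] {C : Set X} (hCc : IsCompact C)
    (hCo : IsOpen C) (c : ℂ) : (C.indicator fun _ => c) ∈ SchwartzBruhat X := by
  rw [mem_schwartzBruhat_iff]
  refine ⟨isLocallyConstant_indicator_const_of_isClopen ⟨hCc.isClosed, hCo⟩ c, ?_⟩
  exact HasCompactSupport.intro hCc fun x hx => indicator_of_notMem hx _

/-- in a locally compact Hausdorff totally disconnected space every neighbourhood contains a COMPACT OPEN neighbourhood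
(such a space is an `l`-space: the compact open sets form a basis of the topology). [cite: BernsteinZelevinsky1976, §1.1] -/
theorem exists_isCompact_isOpen_mem_subset [LocallyCompactSpace X] [T2Space X] [TotallyDisconnectedSpace X]
    {x : X} {U : Set X} (hU : IsOpen U) (hx : x ∈ U) :
    ∃ C : Set X, IsCompact C ∧ IsOpen C ∧ x ∈ C ∧ C ⊆ U := by
  obtain ⟨K, hKc, hxK, hKU⟩ := exists_compact_subset hU hx
  obtain ⟨C, hCo, hCU, hCint⟩ :=
    (loc_compact_Haus_tot_disc_of_zero_dim (H := X)).mem_nhds_iff.1 (isOpen_interior.mem_nhds hxK)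
  -- `C` clopen, `x ∈ C ⊆ interior K`
  refine ⟨C, hKc.of_isClosed_subset hCo.1 (hCint.trans interior_subset), hCo.2, hCU, ?_⟩
  exact hCint.trans (interior_subset.trans hKU)

variable [MeasurableSpace X] [OpensMeasurableSpace X] (μ : Measure X)

/-- `conj f · g` is integrable for Schwartz–Bruhat `f` and continuous `g` (μ finite on compacts): a locally constant
compactly supported function against a Radon measure. [cite: BernsteinZelevinsky1976, §1.3] [cite: Bruhat1961, §9] -/
theorem integrable_conj_schwartzBruhat_mul [IsFiniteMeasureOnCompacts μ] (f : SchwartzBruhat X) {g : X → ℂ}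
    (hg : Continuous g) : Integrable (fun x => conj ((f : X → ℂ) x) * g x) μ := by
  refine Continuous.integrable_of_hasCompactSupport ?_ ?_
  · exact (Complex.continuous_conj.comp (continuous_schwartzBruhat f)).mul hg
  · exact ((hasCompactSupport_schwartzBruhat f).comp_left (g := (starRingEnd ℂ : ℂ → ℂ)) (map_zero _)).mul_right

/-- `k · f` is integrable for continuous `k` and Schwartz–Bruhat `f` (μ finite on compacts): a locally constant
compactly supported function against a Radon measure. [cite: BernsteinZelevinsky1976, §1.3] [cite: Bruhat1961, §9] -/
theorem integrable_mul_schwartzBruhat [IsFiniteMeasureOnCompacts μ] {k : X → ℂ} (hk : Continuous k)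
    (f : SchwartzBruhat X) : Integrable (fun y => k y * (f : X → ℂ) y) μ :=
  Continuous.integrable_of_hasCompactSupport (hk.mul (continuous_schwartzBruhat f))
    (hasCompactSupport_schwartzBruhat f).mul_left

/-- **positive definiteness of the `L²` pairing on `𝒮(X)`**: `∫ conj f · f dμ = 0 ⇒ f = 0` when `μ` charges non-empty
open sets (`f` is continuous, so `|f|² > 0` on a non-empty open set) — the positive definiteness of the `L²` inner product
on continuous functions. [cite: ReedSimonI1980, §II.1 Example 2] -/
theorem schwartzBruhat_eq_zero_of_integral_conj_mul_self_eq_zero [IsFiniteMeasureOnCompacts μ] [μ.IsOpenPosMeasure]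
    (f : SchwartzBruhat X) (h : ∫ x, conj ((f : X → ℂ) x) * (f : X → ℂ) x ∂μ = 0) : f = 0 := by
  -- `∫ conj f · f = ∫ |f|²` (a real integral)
  have hsq : ∀ x, conj ((f : X → ℂ) x) * (f : X → ℂ) x = ((‖(f : X → ℂ) x‖ ^ 2 : ℝ) : ℂ) := by
    intro x
    rw [Complex.conj_mul', ← Complex.ofReal_pow]
  simp_rw [hsq] at h
  rw [integral_complex_ofReal, Complex.ofReal_eq_zero] at h
  -- the real function `|f|²` is continuous, non-negative, compactly supported and integrates to `0`
  have hcont : Continuous fun x => ‖(f : X → ℂ) x‖ ^ 2 := (continuous_norm.comp (continuous_schwartzBruhat f)).pow 2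
  have hint : Integrable (fun x => ‖(f : X → ℂ) x‖ ^ 2) μ :=
    hcont.integrable_of_hasCompactSupport
      ((hasCompactSupport_schwartzBruhat f).norm.comp_left (g := fun t : ℝ => t ^ 2) (by simp))
  have hnn : 0 ≤ fun x => ‖(f : X → ℂ) x‖ ^ 2 := fun x => by positivity
  by_contra hf
  have hsupp : (Function.support fun x => ‖(f : X → ℂ) x‖ ^ 2).Nonempty := by
    have : (f : X → ℂ) ≠ 0 := fun h0 => hf (Subtype.ext h0)
    obtain ⟨x, hx⟩ := Function.ne_iff.1 this
    exact ⟨x, by simpa [Function.mem_support] using hx⟩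
  have hopen : IsOpen (Function.support fun x => ‖(f : X → ℂ) x‖ ^ 2) := hcont.isOpen_support
  have hpos : 0 < ∫ x, ‖(f : X → ℂ) x‖ ^ 2 ∂μ :=
    (integral_pos_iff_support_of_nonneg hnn hint).2 (hopen.measure_pos μ hsupp)
  exact hpos.ne' h

end Bookkeeping

/-! ## §3 Sesquilinearity of the pairing and the dual family of a basis of a finite-dimensional subspace -/

section Pairing

variable {X : Type*} [TopologicalSpace X]

/-- value of a finite linear combination of Schwartz–Bruhat functions. [folklore] -/
private theorem coe_sum_smul_schwartzBruhat_apply {ι : Type*} (s : Finset ι) (c : ι → ℂ) (g : ι → SchwartzBruhat X) (x : X) :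
    ((∑ i ∈ s, c i • g i : SchwartzBruhat X) : X → ℂ) x = ∑ i ∈ s, c i * (g i : X → ℂ) x := by
  rw [Submodule.coe_sum, Finset.sum_apply]
  refine Finset.sum_congr rfl fun i _ => ?_
  rw [Submodule.coe_smul, Pi.smul_apply, smul_eq_mul]

/-- a vector of a subspace `V ≤ 𝒮(X)` expanded in a basis of `V`, read in `𝒮(X)`. [folklore] -/
private theorem coe_eq_sum_repr_smul {V : Submodule ℂ (SchwartzBruhat X)} {ι : Type*} [Fintype ι]
    (b : Module.Basis ι ℂ V) (w : V) :
    (w : SchwartzBruhat X) = ∑ j, b.repr w j • ((b j : V) : SchwartzBruhat X) := by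
  conv_lhs => rw [← b.sum_repr w]
  rw [Submodule.coe_sum]
  refine Finset.sum_congr rfl fun j _ => ?_
  rw [Submodule.coe_smul]

variable [MeasurableSpace X] [OpensMeasurableSpace X] (μ : Measure X) [IsFiniteMeasureOnCompacts μ]

/-- the pairing `∫ conj f · g` is `ℂ`-linear in the second slot (finite linear combinations) — sesquilinearity of the `L²`
inner product. [cite: ReedSimonI1980, §II.1 Example 2] -/
theorem integral_conj_mul_sum_smul (f : SchwartzBruhat X) {ι : Type*} (s : Finset ι) (c : ι → ℂ)
    (g : ι → SchwartzBruhat X) :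
    ∫ x, conj ((f : X → ℂ) x) * ((∑ i ∈ s, c i • g i : SchwartzBruhat X) : X → ℂ) x ∂μ =
      ∑ i ∈ s, c i * ∫ x, conj ((f : X → ℂ) x) * (g i : X → ℂ) x ∂μ := by
  simp_rw [coe_sum_smul_schwartzBruhat_apply, Finset.mul_sum]
  rw [integral_finsetSum _ fun i _ => ?_]
  · refine Finset.sum_congr rfl fun i _ => ?_
    rw [← integral_const_mul]
    refine integral_congr_ae (Eventually.of_forall fun x => ?_)
    simp only
    ring
  · have := (integrable_conj_schwartzBruhat_mul μ f (continuous_schwartzBruhat (g i))).const_mul (c i)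
    refine this.congr (Eventually.of_forall fun x => ?_)
    simp only
    ring

/-- the pairing `∫ conj f · g` is CONJUGATE-linear in the first slot (finite linear combinations) — sesquilinearity of the
`L²` inner product. [cite: ReedSimonI1980, §II.1 Example 2] -/
theorem integral_conj_sum_smul_mul (g : SchwartzBruhat X) {ι : Type*} (s : Finset ι) (c : ι → ℂ)
    (f : ι → SchwartzBruhat X) :
    ∫ x, conj (((∑ i ∈ s, c i • f i : SchwartzBruhat X) : X → ℂ) x) * (g : X → ℂ) x ∂μ =
      ∑ i ∈ s, conj (c i) * ∫ x, conj ((f i : X → ℂ) x) * (g : X → ℂ) x ∂μ := by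
  simp_rw [coe_sum_smul_schwartzBruhat_apply, map_sum, map_mul, Finset.sum_mul]
  rw [integral_finsetSum _ fun i _ => ?_]
  · refine Finset.sum_congr rfl fun i _ => ?_
    rw [← integral_const_mul]
    refine integral_congr_ae (Eventually.of_forall fun x => ?_)
    simp only
    ring
  · have := (integrable_conj_schwartzBruhat_mul μ (f i) (continuous_schwartzBruhat g)).const_mul (conj (c i))
    refine this.congr (Eventually.of_forall fun x => ?_)
    simp only
    ring

variable [μ.IsOpenPosMeasure]

/-- **the Gram matrix of a linearly independent family is injective** (positive definiteness of the pairing): for a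
basis `b` of `V ≤ 𝒮(X)` and `G i j = ∫ conj (b i) · (b j)`, `G c = 0 ⇒ c = 0` (the Gram matrix of linearly independent
vectors of an inner product space is positive definite, in particular nonsingular). [cite: HornJohnson2013, Thm. 7.2.10] -/
theorem gram_mulVec_injective {V : Submodule ℂ (SchwartzBruhat X)} {ι : Type*} [Fintype ι]
    (b : Module.Basis ι ℂ V) (G : Matrix ι ι ℂ)
    (hG : ∀ i j, G i j =
      ∫ x, conj ((((b i : V) : SchwartzBruhat X) : X → ℂ) x) * (((b j : V) : SchwartzBruhat X) : X → ℂ) x ∂μ) :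
    Function.Injective G.mulVec := by
  -- it suffices that the kernel is trivial
  refine (injective_iff_map_eq_zero (Matrix.mulVecLin G)).2 fun c hc => ?_
  rw [Matrix.mulVecLin_apply] at hc
  -- `w := Σ_j c_j b_j` has `⟪w, w⟫ = Σ_i conj(c_i) (G c)_i = 0`
  have hww : ∫ x, conj (((∑ j, c j • ((b j : V) : SchwartzBruhat X) : SchwartzBruhat X) : X → ℂ) x) *
      ((∑ j, c j • ((b j : V) : SchwartzBruhat X) : SchwartzBruhat X) : X → ℂ) x ∂μ = 0 := by
    rw [integral_conj_sum_smul_mul μ]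
    have h1 : ∀ i, ∫ x, conj ((((b i : V) : SchwartzBruhat X) : X → ℂ) x) *
        ((∑ j, c j • ((b j : V) : SchwartzBruhat X) : SchwartzBruhat X) : X → ℂ) x ∂μ = G.mulVec c i := by
      intro i
      rw [integral_conj_mul_sum_smul μ, Matrix.mulVec, dotProduct]
      exact Finset.sum_congr rfl fun j _ => by rw [hG, mul_comm]
    simp_rw [h1, hc, Pi.zero_apply, mul_zero, Finset.sum_const_zero]
  have hw0 := schwartzBruhat_eq_zero_of_integral_conj_mul_self_eq_zero μ _ hww
  -- linear independence of `b` in `V`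
  have hsum : (∑ j, c j • b j : V) = 0 := by
    apply Subtype.ext
    rw [Submodule.coe_sum, Submodule.coe_zero, ← hw0]
    exact Finset.sum_congr rfl fun j _ => by rw [Submodule.coe_smul]
  have hc0 : b.equivFun.symm c = 0 := by rw [Module.Basis.equivFun_symm_apply]; exact hsum
  exact (LinearEquiv.map_eq_zero_iff _).1 hc0

/-- **DUAL FAMILY.**  A basis `b` of a finite-dimensional subspace `V ≤ 𝒮(X)` has a `⟪·,·⟫`-DUAL family `d i ∈ V`
(`∫ conj (d i) · (b j) = δ_ij`; the Gram matrix is invertible by positive definiteness), the `b`-coordinates of `w ∈ V`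
are `∫ conj (d i) · w`, and `f ↦ Σ_i (∫ conj (d i) · f) b i` is the `⟪·,·⟫`-orthogonal projection onto `V`:
`⟪v, f⟫ = Σ_i ⟪d i, f⟫ ⟪v, b i⟫` for `v ∈ V` (finite-dimensional Riesz lemma / projection theorem, made explicit through the
inverse Gram matrix). [cite: HornJohnson2013, Thm. 7.2.10] [cite: ReedSimonI1980, Thm. II.3, Thm. II.4] -/
theorem exists_dual_family {V : Submodule ℂ (SchwartzBruhat X)} {ι : Type*} [Fintype ι] [DecidableEq ι]
    (b : Module.Basis ι ℂ V) :
    ∃ d : ι → SchwartzBruhat X, (∀ i, d i ∈ V) ∧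
      (∀ i j, ∫ x, conj ((d i : X → ℂ) x) * (((b j : V) : SchwartzBruhat X) : X → ℂ) x ∂μ = if i = j then 1 else 0) ∧
      (∀ (w : V) (i : ι), b.repr w i = ∫ x, conj ((d i : X → ℂ) x) * ((w : SchwartzBruhat X) : X → ℂ) x ∂μ) ∧
      (∀ v ∈ V, ∀ f : SchwartzBruhat X,
        ∫ x, conj ((v : X → ℂ) x) * (f : X → ℂ) x ∂μ =
          ∑ i, (∫ x, conj ((d i : X → ℂ) x) * (f : X → ℂ) x ∂μ) *
            ∫ x, conj ((v : X → ℂ) x) * (((b i : V) : SchwartzBruhat X) : X → ℂ) x ∂μ) := by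
  -- the Gram matrix and its inverse
  obtain ⟨G, hG⟩ : ∃ G : Matrix ι ι ℂ, ∀ i j, G i j =
      ∫ x, conj ((((b i : V) : SchwartzBruhat X) : X → ℂ) x) * (((b j : V) : SchwartzBruhat X) : X → ℂ) x ∂μ :=
    ⟨Matrix.of fun i j =>
      ∫ x, conj ((((b i : V) : SchwartzBruhat X) : X → ℂ) x) * (((b j : V) : SchwartzBruhat X) : X → ℂ) x ∂μ,
      fun i j => rfl⟩
  have hGdet : IsUnit G.det :=
    (Matrix.isUnit_iff_isUnit_det G).1 (Matrix.mulVec_injective_iff_isUnit.1 (gram_mulVec_injective μ b G hG))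
  have hGG : ∀ j l, ∑ i, G j i * G⁻¹ i l = if j = l then 1 else 0 := by
    intro j l
    rw [← Matrix.mul_apply, Matrix.mul_nonsing_inv G hGdet, Matrix.one_apply]
  have hG'G : ∀ i k, ∑ j, G⁻¹ i j * G j k = if i = k then 1 else 0 := by
    intro i k
    rw [← Matrix.mul_apply, Matrix.nonsing_inv_mul G hGdet, Matrix.one_apply]
  -- the dual family `d i := Σ_l conj (G⁻¹ i l) • b l`
  set d : ι → SchwartzBruhat X := fun i => ∑ l, conj (G⁻¹ i l) • ((b l : V) : SchwartzBruhat X) with hd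
  have hdV : ∀ i, d i ∈ V := fun i => Submodule.sum_mem _ fun l _ => Submodule.smul_mem _ _ (b l).2
  -- `⟪d i, g⟫ = Σ_l G⁻¹ i l ⟪b l, g⟫`
  have hdpair : ∀ (i : ι) (g : SchwartzBruhat X), ∫ x, conj ((d i : X → ℂ) x) * (g : X → ℂ) x ∂μ =
      ∑ l, G⁻¹ i l * ∫ x, conj ((((b l : V) : SchwartzBruhat X) : X → ℂ) x) * (g : X → ℂ) x ∂μ := by
    intro i g
    rw [hd]
    dsimp only
    rw [integral_conj_sum_smul_mul μ]
    simp only [Complex.conj_conj]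
  clear_value d
  have hdual : ∀ i j, ∫ x, conj ((d i : X → ℂ) x) * (((b j : V) : SchwartzBruhat X) : X → ℂ) x ∂μ =
      if i = j then 1 else 0 := by
    intro i j
    rw [hdpair, ← hG'G i j]
    exact Finset.sum_congr rfl fun l _ => by rw [hG]
  refine ⟨d, hdV, hdual, ?_, ?_⟩
  · -- coordinates
    intro w i
    rw [coe_eq_sum_repr_smul b w, integral_conj_mul_sum_smul μ]
    simp_rw [hdual, mul_ite, mul_one, mul_zero]
    rw [Finset.sum_ite_eq]
    simp
  · -- resolution of the identity on `V`: first for `v = b j`, then by conjugate-linearity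
    have hbj : ∀ (j : ι) (f : SchwartzBruhat X),
        ∫ x, conj ((((b j : V) : SchwartzBruhat X) : X → ℂ) x) * (f : X → ℂ) x ∂μ =
          ∑ i, (∫ x, conj ((d i : X → ℂ) x) * (f : X → ℂ) x ∂μ) *
            ∫ x, conj ((((b j : V) : SchwartzBruhat X) : X → ℂ) x) *
              (((b i : V) : SchwartzBruhat X) : X → ℂ) x ∂μ := by
      intro j f
      simp_rw [hdpair, ← hG, Finset.sum_mul]
      rw [Finset.sum_comm]
      have : ∀ l, ∑ i, G⁻¹ i l * (∫ x, conj ((((b l : V) : SchwartzBruhat X) : X → ℂ) x) * (f : X → ℂ) x ∂μ) *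
          G j i = (if j = l then 1 else 0) *
            ∫ x, conj ((((b l : V) : SchwartzBruhat X) : X → ℂ) x) * (f : X → ℂ) x ∂μ := by
        intro l
        rw [← hGG j l, Finset.sum_mul]
        exact Finset.sum_congr rfl fun i _ => by ring
      simp_rw [this, ite_mul, one_mul, zero_mul]
      rw [Finset.sum_ite_eq]
      simp
    intro v hv f
    -- expand `v` in the basis
    rw [show (v : SchwartzBruhat X) = ((⟨v, hv⟩ : V) : SchwartzBruhat X) from rfl, coe_eq_sum_repr_smul b ⟨v, hv⟩,
      integral_conj_sum_smul_mul μ]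
    simp_rw [integral_conj_sum_smul_mul μ, Finset.mul_sum]
    rw [Finset.sum_comm]
    refine Finset.sum_congr rfl fun j _ => ?_
    rw [hbj j f, Finset.mul_sum]
    refine Finset.sum_congr rfl fun i _ => ?_
    ring

end Pairing

end Literature.RepresentationTheory.HeisenbergGroup

end
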